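import Literature.MathematicalPhysics.QuantumFieldTheory.Balaban1983to89.B6NormSuppDecayWindowV1
import Literature.MathematicalPhysics.QuantumFieldTheory.Balaban1983to89.B6Ineq112NormSuppTS
import Literature.MathematicalPhysics.QuantumFieldTheory.Balaban1983to89.B6CubeInDecayV1

/-!
# `Balaban1983to89.B6CubeNormSuppInDecayV1` — T. Bałaban, *Propagators and renormalization transformations for lattice gauge theories. II*,
# Commun. Math. Phys. **96** (1984) 223–250 [Balaban1984PropagatorsII], Prop. 2.6 (2.138) p. 247 with (2.133) p. 247, (2.90)–(2.94) p. 239 and p. 238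
# (`T_□ = □̃³`): THE TWO-DIFFERENCE MEMBER `E_(μ,+)·G_□·E_(ν,−) = ∇_μG_□∇_ν*` OF A CUBE ON THE HÖLDER CLASS OF (2.138), AT k LEVELS — the `NormSupp` twin of
# r03's `…B6CubeInDecayV1.hGin_cube` (the CORE file of `HOME/lit-balaban-p27/WAKE-2138-legs.md`)

statement-level skeleton of published theorems with citation tags; proofs where landed; nothing here is a claim about the Yang–Mills mass gap

PDF held: `paper:balaban1984-cmp96-propagators-rt-ii` (journal page = PDF page + 222): p. 238 [PDF 16] (□ ⊂ □̃ ⊂ □̃² ⊂ □̃³ = T_□), p. 239 [PDF 17]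
((2.90)–(2.94): `G_□`, the rescaling `s(□)`), p. 247 [PDF 25] ((2.133); (2.138): *"|(∇G∇*J)(x)| ≤ O(1)e^{−δ₃d(y,y′)}(‖J‖^{ξ′}_ε + |J|) for
0 < ε < 1, x ∈ Δ(y), supp J ⊂ Δ̃(y′), y′ ∈ Λ_{j′}, ξ′ = L^{−j′}"*, *"reasoning in the same way as in the proof of Proposition 2.2"*); [Balaban1984PropagatorsI] Prop. 1.2
(1.112) p. 36 (the member estimate `|(∇G∇*J)(x)| ≤ O(1)e^{−δ₀|y−y′|}(‖J‖_ε + |J|)`).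

CITATION HEADER (lean-in-tree rule) — WHAT IS REPRODUCED.  Phase-2 file of the `lit-balaban` typed skeleton (HOME `run/shared/lean/pub/lit-balaban/`), seat
**p27 gen 90** (TAKING HOME/STATUS 2026-08-24T22:31Z on p38 g34's named offer; `WAKE-2138-legs.md` CORE; B6 fold owner r03); SKELETON rows **B6.Eq2.138** ×
B6.Eq2.133 × B6.Eq1.112 × B6.Prop2.6 (cells only; decls of record untouched).  In the walk (2.141) read for the entry `|(∇G∇*J)(x)|` of (2.138) the
letters with BOTH differences on one member (`∇_μ(h_□G_□h_□)∇*_ν` at `n = 0`, the `c₁∇`-part of `K_{□,□′}G_{□′}h_{□′}∇*_ν`) are the member (1.112) read on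
the global lattice; unlike `G_□J`, `∇G_□J` they are bounded only on the HÖLDER class `‖J‖_ε + |J|` (not on `|J|` alone), so r03's sup-class bridge
`hGin_cube` does not apply.  THIS FILE fires the Hölder-class bridge `…B6NormSuppDecayWindowV1.normSuppDecay_window_V1` on a cube:
* §1 **`hasMajorantA_conj_chart`** — the relabelling `τ_{−v}T₂τ_v` from the chart frame `D.chart s` to the global frame `D` for the in-reach Hölder class
  (the `HasMajorantA` twin of `…B6InMajorantTransplant.inMajorant_conj_chart`; the census functionals `holderV1`/`supNormV1` of `…B6HolderNormV1` are
  translation invariant: `admV1_translate_iff`, `tparV1_translate`, `holderV1_translate`, `supNormV1_translate`);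
* §2 **`deep_of_blkV1_mem_SQ`** — a bond whose chart block lies in the reach `□⁺` is `S_j`-deep in the window (`L ≥ 5`; the new hypothesis `hdeep` of the
  Hölder bridge, from r03's `dist_lt_of_blkOf_mem_Q` + `deep_of_dist_le`);
* §3 **`normSuppDecay_cube`** — for ANY member operator `T′` of the cube with a Hölder-class majorant `A·e^{−δ|·|_{T_□}}` (radius `L − 1`):
  `HasMajorantA (geomT D) (blkV1 hN D) (y′ ∈ Q^T_□ ∧ NormSupp (blkV1) {y′} (holderV1 ε + supNormV1)) (τ_{−v}(εT′ρ)τ_v) (3A·e^{2δ/9}·e^{−(δ/(9(d+1)))·d_T})`;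
* §4 **`hDGDla_cube`** — the instance `T′ = ∇_μG_□∇_ν*` of [Balaban1984PropagatorsI] (1.112) (p27's `…B6Ineq112NormSuppTS.ineq112_hasMajorantA_rad` at
  radius `L − 1`): ONE `(ρ, C_ε)` on `d, L, a₀, a₁, ε` for all tori, cubes, weights, `c′`, `μ, ν` — print's `O(1)e^{−δ₃d}(‖J‖_ε + |J|)` for the letter,
  NO length prefactor; and **`EC_Gl_EC_eq`** + **`hEGE_cube`**: p38's `E_(μ,+)·G_□·E_(ν,−)` (`…B6Eq292MemberTorusV1.EC`, `…B6CubeWindowV1.Gl`) IS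
  `s(□)⁻¹•` that conjugated transplant, so it has the majorant `s(□)⁻¹·C_ε·e^{−ρ d_T}` on the same class (the factor `s(□)⁻¹ = (L^{j₀}/c′)²` is cancelled
  by the two `(c′/L^{j₀})` of `…B6GradLegKLevelV1.mulOp_mul_EC_true` in the legs).
THEOREMS ONLY (no `def`, no `def … : Prop`); standard axioms.  Imports `…B6NormSuppDecayWindowV1` + `…B6Ineq112NormSuppTS` (p27), `…B6CubeInDecayV1` (r03).

HONEST SCOPE / DIVERGENCES. (1) `L ≥ 5`, `M_h = Lᵃ ≥ 2`, `R ≥ 2L²`, `P′ ≥ 4`, cube placed — as `hGin_cube`.  (2) Inputs restricted to the reach `Q^T_□`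
(class `y′ ∈ ST`), outputs anywhere; the cut-offs of the legs restore the unrestricted class (`…B6NormSuppDecayWindowV1.hasMajorantA_mul_right_ind`).
(3) Rate `δ/(9(d+1))`, factor `3`, radius `L − 1`: ours.  (4) The region of the class is the census block `{y′}` (print's `Δ̃(y′)` is larger; see
`…B6RandomWalkInputNorm` HONEST SCOPE).  Bookkeeping over landed estimates; the legs (L0) and the assembly of (2.138) are NOT here; NOT summit progress.
Unit `lit-balaban-p27` (gen 90), 2026-08-25.
-/

noncomputable section

open scoped BigOperators
open Finset

namespace Literature.MathematicalPhysics.QuantumFieldTheory.Balaban1983to89.B6CubeNormSuppInDecayV1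

open LatticeFieldCalculus
open B3TorusRadialSums (supDist_comm)
open B4Reflection242 (boxDom)
open B5Eq118OneStroke (iterBlockOf)
open B6MultiLevelBoxOperator (N0 bigSide)
open B6MultiLevelTorusOperator (TDomains)
open B6Eq238MultiLevelTorus (svec)
open B6Cover236MultiLevelBlocks (cubes)
open B6Geom246MultiLevelBox (bset)
open B6Geom246MultiLevelTorus (geomT bondT blkMap blkMap_injective)
open B6TorusDepthDistance (distT_chart_eq)
open B6GlobalChartV1 (PV toBox blkV1 domT)
open B6AgreeLapV1Chart (cB eB DeepS deepS_mono mem_cB_W)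
open B6TranslateV1 (tv)
open B6TranslateTorusV1 (vch TB conj_apply blkV1_translate blkMap_fst)
open B6Prop25TwoScaleCensus (TSIdx)
open B6Ineq2133TwoScaleV1 (tsGeo onFun)
open B6AgreeLapV1Chart (onFun_comp)
open B6Prop26ReachTransplant (transplant transplant_mul_of_bij)
open B6Prop26KLevelSkeletonV1 (ST)
open B6Partition118KLevelTorusCentral (one_le_of_four_le)
open B6SectAOperatorsV1 (BondIdx)
open B6RandomWalkInputNorm (HasMajorantA NormSupp hasMajorantA_smul hasMajorantA_mono)
open B6HolderNormV1 (AdmV1 tparV1 supNormV1 holderV1)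
open B6HolderPairWindowV1 (supDist_translate)
open B6NormSuppDecayWindowV1 (normSuppDecay_window_V1 hasMajorantA_inCl_congr_set)
open B6Ineq112NormSuppTS (ineq112_hasMajorantA_rad)
open B6Eq292MemberTorusV1 (EC)
open B6CubeWindowV1 (x0 j0 tC tC_j sc hx0 hfit Placed wC Gl SQ mem_SQ mem_blkMap_image_SQ dist_lt_of_blkOf_mem_Q deep_of_dist_le j0_hj
  one_le_bigSide_real)
open B6CubeInDecayV1 (j0_le_succ hdiv_cube hlev_full hband_cube conj_mul EC_mul_Gl_eq sc_nonneg)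

variable {d ℓ : ℕ} {hd : 1 ≤ d + 1} {hL : Odd (ℓ + 1) ∧ 1 < ℓ + 1} {a₀ a₁ : ℝ} {m K : ℕ} {Mh k R : ℕ} {P' : Fin (d + 1) → ℕ}

/-! ## §1  The in-reach Hölder class in the chart frame and in the global frame -/

section Chart

variable (hN : ∀ μ, N0 ℓ Mh k P' μ = (PV d ℓ m K hd hL).sitesPerDir 0) (D : TDomains d ℓ Mh k P' R) (hMh : 1 ≤ Mh) (hP : ∀ μ, 1 ≤ P' μ)
  (s : Fin (d + 1) → ℤ)

include hMh hP in
/-- the level of the block of a translated bond is the chart level. [cite: Balaban1984PropagatorsII, (2.45) p.231, dictionary (charts)] -/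
theorem level_translate (b : PBond (PV d ℓ m K hd hL) 0) :
    (blkV1 hN D (b.translate (vch Mh k s))).1.1 = (blkV1 hN (D.chart s) b).1.1 := by
  rw [blkV1_translate hN D hMh hP s b, blkMap_fst D hMh hP s]

include hMh hP in
/-- admissibility of a pair is invariant under the chart translation. [cite: Balaban1984PropagatorsII, (2.137)–(2.138) p.247 + (2.45) p.231, dictionary (charts)] -/
theorem admV1_translate_iff (b b' : PBond (PV d ℓ m K hd hL) 0) :
    AdmV1 hN D (b.translate (vch Mh k s)) (b'.translate (vch Mh k s)) ↔ AdmV1 hN (D.chart s) b b' := by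
  unfold AdmV1
  rw [supDist_translate, level_translate hN D hMh hP s b, level_translate hN D hMh hP s b']
  exact Iff.rfl

include hMh hP in
/-- the pair parameter is invariant under the chart translation. [cite: Balaban1984PropagatorsII, (2.137)–(2.138) p.247 + (2.45) p.231, dictionary (charts)] -/
theorem tparV1_translate (b b' : PBond (PV d ℓ m K hd hL) 0) :
    tparV1 hN D (b.translate (vch Mh k s)) (b'.translate (vch Mh k s)) = tparV1 hN (D.chart s) b b' := by
  unfold tparV1
  rw [supDist_translate, level_translate hN D hMh hP s b]

/-- the translation equivalence acts by translation. [folklore] -/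
private theorem translateEquiv_apply (v : Site (PV d ℓ m K hd hL) 0) (b : PBond (PV d ℓ m K hd hL) 0) :
    (PBond.translateEquiv v) b = b.translate v := rfl

include hMh hP in
/-- `‖τ_v J‖_ε = ‖J‖_ε` (chart frame vs global frame). [cite: Balaban1984PropagatorsII, (2.138) p.247 + (2.45) p.231, dictionary (charts)] -/
theorem holderV1_translate (ε : ℝ) (J : PBond (PV d ℓ m K hd hL) 0 → ℝ) :
    holderV1 hN (D.chart s) ε (J ∘ PBond.translateEquiv (vch (m := m) (K := K) Mh k s)) = holderV1 hN D ε J := by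
  unfold holderV1
  refine Equiv.iSup_congr ((PBond.translateEquiv (vch (m := m) (K := K) Mh k s)).prodCongr
    (PBond.translateEquiv (vch (m := m) (K := K) Mh k s))) fun q => ?_
  simp only [Equiv.prodCongr_apply, Prod.map, Function.comp, translateEquiv_apply]
  rw [tparV1_translate hN D hMh hP s]
  exact if_congr (admV1_translate_iff hN D hMh hP s q.1 q.2) rfl rfl

/-- `|τ_v J| = |J|`. [cite: Balaban1984PropagatorsII, p.231, dictionary (charts)] -/
theorem supNormV1_translate (J : PBond (PV d ℓ m K hd hL) 0 → ℝ) :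
    supNormV1 (J ∘ PBond.translateEquiv (vch (m := m) (K := K) Mh k s)) = supNormV1 J := by
  unfold supNormV1
  exact Equiv.iSup_congr (PBond.translateEquiv (vch (m := m) (K := K) Mh k s)) fun _ => rfl

include hMh hP in
/-- distances of blocks are chart-invariant (`distT_chart_eq` read in `ℝ`). [cite: Balaban1984PropagatorsII, (2.46) p.231, dictionary (charts)] -/
theorem dist_blkMap (a b : (geomT (D.chart s)).Site) :
    (geomT D).dist (blkMap D s a) (blkMap D s b) = (geomT (D.chart s)).dist a b := by
  show (((bondT D).dist (blkMap D s a) (blkMap D s b) : ℕ) : ℝ) = (((bondT (D.chart s)).dist a b : ℕ) : ℝ)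
  rw [distT_chart_eq hMh hP s]

include hMh hP in
/-- **THE IN-REACH HÖLDER CLASS IN THE CHART FRAME IS THE ONE IN THE GLOBAL FRAME**: a `HasMajorantA` of `T₂` on `geomT (D.chart s)` for the class
`y′ ∈ S ∧ NormSupp (blkV1 (D.chart s)) {y′} (‖·‖_ε + |·|)` is one of the conjugate `τ_{−v}T₂τ_v` on `geomT D` for the class at the reach `blkMap″S`, with
any kernel dominating `K` through the block map. [cite: Balaban1984PropagatorsII, (2.138) p.247 + (2.45)–(2.46) p.231, dictionary (charts)] -/
theorem hasMajorantA_conj_chart {ε : ℝ} {T₂ : Module.End ℝ (PBond (PV d ℓ m K hd hL) 0 → ℝ)} {S : Set (geomT (D.chart s)).Site}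
    {K₂ : (geomT (D.chart s)).Site → (geomT (D.chart s)).Site → ℝ} {K₁ : (geomT D).Site → (geomT D).Site → ℝ}
    (h₂ : HasMajorantA (g := geomT (D.chart s)) (blkV1 hN (D.chart s))
      (fun J y' B => y' ∈ S ∧ NormSupp (g := geomT (D.chart s)) (blkV1 hN (D.chart s)) (fun y' => ({y'} : Set (geomT (D.chart s)).Site))
        (fun _ J => holderV1 hN (D.chart s) ε J + supNormV1 J) J y' B) T₂ K₂)
    (hK : ∀ a b, K₂ a b ≤ K₁ (blkMap D s a) (blkMap D s b)) :
    HasMajorantA (g := geomT D) (blkV1 hN D)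
      (fun J y' B => y' ∈ blkMap D s '' S ∧ NormSupp (g := geomT D) (blkV1 hN D) (fun y' => ({y'} : Set (geomT D).Site))
        (fun _ J => holderV1 hN D ε J + supNormV1 J) J y' B)
      (TB (-vch Mh k s) * T₂ * TB (vch Mh k s)) K₁ := by
  intro y' μ B hμB x
  obtain ⟨hyS, hμ⟩ := hμB
  obtain ⟨y₂, hy₂S, rfl⟩ := hyS
  obtain ⟨x₂, rfl⟩ := (PBond.translateEquiv (vch (m := m) (K := K) Mh k s)).surjective x
  rw [conj_apply]
  have hμ₂ : NormSupp (g := geomT (D.chart s)) (blkV1 hN (D.chart s)) (fun y' => ({y'} : Set (geomT (D.chart s)).Site))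
      (fun _ J => holderV1 hN (D.chart s) ε J + supNormV1 J) (μ ∘ PBond.translateEquiv (vch (m := m) (K := K) Mh k s)) y₂ B := by
    refine ⟨hμ.nonneg, ?_, fun b hb => ?_⟩
    · rw [holderV1_translate hN D hMh hP s, supNormV1_translate s]
      exact hμ.bound
    · refine hμ.off _ fun hmem => hb ?_
      have e : blkV1 hN D ((PBond.translateEquiv (vch (m := m) (K := K) Mh k s)) b) = blkMap D s (blkV1 hN (D.chart s) b) :=
        blkV1_translate hN D hMh hP s b
      rw [Set.mem_singleton_iff] at hmem ⊢
      rw [e] at hmem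
      exact blkMap_injective hMh hP s hmem
  have e2 : blkV1 hN D ((PBond.translateEquiv (vch (m := m) (K := K) Mh k s)) x₂) = blkMap D s (blkV1 hN (D.chart s) x₂) :=
    blkV1_translate hN D hMh hP s x₂
  rw [e2]
  exact (h₂ y₂ _ B ⟨hy₂S, hμ₂⟩ x₂).trans (mul_le_mul_of_nonneg_right (hK _ _) hμ.nonneg)

end Chart

/-! ## §2  The reach of a cube is `S_j`-deep in its window (`L ≥ 5`) -/

section Cube

variable (hN : ∀ μ, N0 ℓ Mh k P' μ = (PV d ℓ m K hd hL).sitesPerDir 0) {D : TDomains d ℓ Mh k P' R} (hk : k ≤ m + K)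
  (hMh1 : 1 ≤ Mh) (hP4 : ∀ μ, 4 ≤ P' μ) {a : ℕ} (hMha : Mh = (ℓ + 1) ^ a) (c : ↥(cubes D.toDomains)) (ha : a₀ ≤ a₁)

include hMha in
/-- **A BOND WHOSE CHART BLOCK LIES IN `□⁺` IS `S_j`-DEEP IN THE WINDOW** (`L ≥ 5`, `M_h ≥ 2`, `R ≥ 2L`): the reach sits within `3S_j/2` of the centre,
the window is `[ctr − L·S_j/2, ctr + 3L·S_j/2)`, and `3S_j/2 + S_j ≤ L·S_j/2` for `L ≥ 5`.
[cite: Balaban1984PropagatorsII, p.238 (□ ⊂ □̃ ⊂ □̃² ⊂ □̃³ = T_□), p.235; derivation ours] -/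
theorem deep_of_blkV1_mem_SQ (hℓ : 4 ≤ ℓ) (hMh : 2 ≤ Mh) (hR : 2 * (ℓ + 1) ≤ R)
    (wc : BondIdx (domT hN (D.chart (svec ℓ k c.1.1 c.1.2)) hk) → ℝ) (cf : ℝ) {b : PBond (PV d ℓ m K hd hL) 0}
    (hb : blkV1 hN (D.chart (svec ℓ k c.1.1 c.1.2)) b ∈ SQ hMh1 hP4 c) :
    b.src ∈ DeepS (tC hN hk hMh1 hP4 c ha a wc cf) (x0 ℓ Mh k c.1) (bigSide ℓ Mh c.1.1) := by
  have hdist := dist_lt_of_blkOf_mem_Q hMh1 hP4 c hMh hR (z := toBox hN b.src) ((mem_SQ hMh1 hP4 c _).1 hb)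
  refine deep_of_dist_le hN hMh1 hP4 hMha c (j0_hj hMh1 hP4 c a) ha ?_
  have hS := one_le_bigSide_real (ℓ := ℓ) hMh1 c.1.1
  have hℓr : (4 : ℝ) ≤ ℓ := by exact_mod_cast hℓ
  nlinarith

/-- `L^{j₀} ≤ S_j` (`j₀ ≤ j + 1`, `M_h ≥ 1`). [cite: Balaban1984PropagatorsII, (2.1) p.224, bookkeeping] -/
theorem pow_j0_le_bigSide : (ℓ + 1) ^ j0 hMh1 hP4 c ≤ bigSide ℓ Mh c.1.1 := by
  unfold bigSide
  calc (ℓ + 1) ^ j0 hMh1 hP4 c ≤ (ℓ + 1) ^ (c.1.1 + 1) := Nat.pow_le_pow_right (Nat.succ_pos ℓ) (j0_le_succ hMh1 hP4 c)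
    _ ≤ Mh * (ℓ + 1) ^ (c.1.1 + 1) := Nat.le_mul_of_pos_left _ hMh1

/-! ## §3  The Hölder-class bridge fired on a cube: any member operator -/

include hMha in
/-- **THE HÖLDER-CLASS BRIDGE ON A CUBE**: for every member operator `T′` of the cube's `T_□` with an admissible-input majorant `A·e^{−δ|·|_{T_□}}` on the
member Hölder class of radius `L − 1` (`ε ≥ 0`), the conjugated full-window transplant `τ_{−v}(εT′ρ)τ_v` has, for the census Hölder class
«supp J ⊂ Δ(y′), ‖J‖_ε + |J| ≤ B» at inputs `y′ ∈ Q^T_□`, the majorant `3A·e^{2δ/9}·e^{−(δ/(9(d+1)))·d_T}` (`L ≥ 5`, `M_h ≥ 2`, `R ≥ 2L²`, cube placed).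
[cite: Balaban1984PropagatorsII, (2.138) p.247, (2.133) p.247, (2.90)–(2.91) p.239, p.238 (T_□ = □̃³)] -/
theorem normSuppDecay_cube (hℓ : 4 ≤ ℓ) (hMh : 2 ≤ Mh) (hR2 : 2 * (ℓ + 1) ^ 2 ≤ R) (hpl : Placed ℓ k P' c.1)
    (w : BondIdx (domT hN D hk) → ℝ) (cf : ℝ) {ε A δ : ℝ} (hε : 0 ≤ ε) (hA : 0 ≤ A) (hδ : 0 ≤ δ)
    {T' : Module.End ℝ (PBond (tC hN hk hMh1 hP4 c ha a (wC hN hk c w) cf).P 0 → ℝ)}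
    (hT' : HasMajorantA (g := tsGeo (tC hN hk hMh1 hP4 c ha a (wC hN hk c w) cf) 0 0)
      (fun β : PBond (tC hN hk hMh1 hP4 c ha a (wC hN hk c w) cf).P 0 => iterBlockOf (tC hN hk hMh1 hP4 c ha a (wC hN hk c w) cf).j β.src)
      (NormSupp (g := tsGeo (tC hN hk hMh1 hP4 c ha a (wC hN hk c w) cf) 0 0)
        (fun β : PBond (tC hN hk hMh1 hP4 c ha a (wC hN hk c w) cf).P 0 => iterBlockOf (tC hN hk hMh1 hP4 c ha a (wC hN hk c w) cf).j β.src)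
        (fun y' => {y'' | (tC hN hk hMh1 hP4 c ha a (wC hN hk c w) cf).tdist y'' y' ≤ (ℓ : ℝ)})
        (fun _ f => (tC hN hk hMh1 hP4 c ha a (wC hN hk c w) cf).hqB ε (WithLp.toLp 2 f) +
          (tC hN hk hMh1 hP4 c ha a (wC hN hk c w) cf).supNormTS (.vec (WithLp.toLp 2 f))))
      T' (fun y y' => A * Real.exp (-(δ * (tC hN hk hMh1 hP4 c ha a (wC hN hk c w) cf).tdist y y')))) :
    HasMajorantA (g := geomT D) (blkV1 hN D)
      (fun J y' B => y' ∈ ST D hMh1 hP4 c ∧ NormSupp (g := geomT D) (blkV1 hN D) (fun y' => ({y'} : Set (geomT D).Site))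
        (fun _ J => holderV1 hN D ε J + supNormV1 J) J y' B)
      (TB (-vch Mh k (svec ℓ k c.1.1 c.1.2)) *
        transplant (cB (tC hN hk hMh1 hP4 c ha a (wC hN hk c w) cf) (x0 ℓ Mh k c.1) (hx0 hpl) (hfit hN hMh1 hP4 hMha c ha hpl)).W
          (eB (tC hN hk hMh1 hP4 c ha a (wC hN hk c w) cf) (x0 ℓ Mh k c.1)) T' *
        TB (vch Mh k (svec ℓ k c.1.1 c.1.2)))
      (fun y y' => 3 * (A * Real.exp (δ * ((d + 1 : ℝ) + (d + 1)) / ((d + 1) * ((9 : ℕ) : ℝ)))) *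
        Real.exp (-(δ / ((d + 1) * ((9 : ℕ) : ℝ)) * (geomT D).dist y y'))) := by
  have hP : ∀ μ, 1 ≤ P' μ := one_le_of_four_le hP4
  have hR : 2 * (ℓ + 1) ≤ R := le_trans (by nlinarith : 2 * (ℓ + 1) ≤ 2 * (ℓ + 1) ^ 2) hR2
  -- the Hölder bridge in the chart frame
  have h1 := normSuppDecay_window_V1 (t := tC hN hk hMh1 hP4 c ha a (wC hN hk c w) cf) (x₀ := x0 ℓ Mh k c.1) (hx₀ := hx0 hpl)
    (hfit := hfit hN hMh1 hP4 hMha c ha hpl) hN (D.chart (svec ℓ k c.1.1 c.1.2)) hA hδ hε hT' hMh1 hP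
    (hdiv_cube hN hk hMh1 hP4 c ha (wC hN hk c w) cf) (hlev_full hN hk hMh1 hP4 hMha c ha hR2 (wC hN hk c w) cf) (C := 9) (by norm_num)
    (SQ hMh1 hP4 c) (fun b _ hbS => hband_cube hN hk hMh1 hP4 hMha c ha hℓ hMh hR2 (wC hN hk c w) cf b hbS)
    (fun b _ hbS => deepS_mono (pow_j0_le_bigSide hMh1 hP4 c)
      (deep_of_blkV1_mem_SQ hN hk hMh1 hP4 hMha c ha hℓ hMh hR (wC hN hk c w) cf hbS))
  -- back to the global frame; the reach `Q^T_□` is the block-map image of `□⁺`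
  have h2 := hasMajorantA_conj_chart hN D hMh1 hP (svec ℓ k c.1.1 c.1.2) h1
    (K₁ := fun y y' => 3 * (A * Real.exp (δ * ((d + 1 : ℝ) + (d + 1)) / ((d + 1) * ((9 : ℕ) : ℝ)))) *
      Real.exp (-(δ / ((d + 1) * ((9 : ℕ) : ℝ)) * (geomT D).dist y y')))
    (fun a b => by rw [dist_blkMap D hMh1 hP])
  exact hasMajorantA_inCl_congr_set (g := geomT D) (blkV1 hN D) (fun y hy => (mem_blkMap_image_SQ hMh1 hP4 c y).2 hy) h2

/-! ## §4  The instance `∇_μG_□∇_ν*` of (1.112), and p38's `E_(μ,+)·G_□·E_(ν,−)` -/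

include hMha in
/-- **`E_(μ,+)·G_□·E_(ν,−)` OF THE CUBE = `τ_{−v}(s(□)⁻¹•ε(∇_μG_□∇_ν*)ρ)τ_v`**: the product of the three transplants through the BIJECTIVE full window is the
transplant of the product. [cite: Balaban1984PropagatorsII, (2.92) p.239 (line 1), (2.94) p.239, p.238 (T_□ = □̃³), dictionary (charts)] -/
theorem EC_Gl_EC_eq (hpl : Placed ℓ k P' c.1) (w : BondIdx (domT hN D hk) → ℝ) (cf : ℝ) (μ ν : Fin (d + 1)) :
    EC hN hk hMh1 hP4 hMha c ha hpl w cf (μ, true) * Gl hN hk hMh1 hP4 hMha c ha hpl w cf * EC hN hk hMh1 hP4 hMha c ha hpl w cf (ν, false) =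
      TB (-vch Mh k (svec ℓ k c.1.1 c.1.2)) *
        ((sc hMh1 hP4 c cf)⁻¹ •
          transplant (cB (tC hN hk hMh1 hP4 c ha a (wC hN hk c w) cf) (x0 ℓ Mh k c.1) (hx0 hpl) (hfit hN hMh1 hP4 hMha c ha hpl)).W
            (eB (tC hN hk hMh1 hP4 c ha a (wC hN hk c w) cf) (x0 ℓ Mh k c.1))
            (onFun ((tC hN hk hMh1 hP4 c ha a (wC hN hk c w) cf).Dl μ ∘ₗ (tC hN hk hMh1 hP4 c ha a (wC hN hk c w) cf).D.G ∘ₗ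
              (tC hN hk hMh1 hP4 c ha a (wC hN hk c w) cf).Dla ν))) *
        TB (vch Mh k (svec ℓ k c.1.1 c.1.2)) := by
  rw [EC_mul_Gl_eq]
  unfold EC
  simp only [Bool.false_eq_true, if_false, if_true]
  rw [conj_mul, smul_mul_assoc,
    ← transplant_mul_of_bij (W := (cB (tC hN hk hMh1 hP4 c ha a (wC hN hk c w) cf) (x0 ℓ Mh k c.1) (hx0 hpl) (hfit hN hMh1 hP4 hMha c ha hpl)).W)
      (e := eB (tC hN hk hMh1 hP4 c ha a (wC hN hk c w) cf) (x0 ℓ Mh k c.1))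
      (cB (tC hN hk hMh1 hP4 c ha a (wC hN hk c w) cf) (x0 ℓ Mh k c.1) (hx0 hpl) (hfit hN hMh1 hP4 hMha c ha hpl)).inj
      (cB (tC hN hk hMh1 hP4 c ha a (wC hN hk c w) cf) (x0 ℓ Mh k c.1) (hx0 hpl) (hfit hN hMh1 hP4 hMha c ha hpl)).surj]
  conv_rhs => rw [← LinearMap.comp_assoc, onFun_comp, ← Module.End.mul_eq_comp]

end Cube

section Letter

/-- **THE LETTER `∇_μG_□∇_ν*` OF (2.138) ON THE CENSUS HÖLDER CLASS, PER CUBE** (`L ≥ 5`): there are `ρ > 0` (on `d, L, a₀, a₁`) and, for every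
`0 < ε < 1`, `C_ε ≥ 0` such that for every V1 global torus, torus family `D`, cube `□` (placed), weights `w`, fine factor `c′` and directions `μ, ν` the
conjugated full-window transplant of the member's `∇_μG_□∇_ν*` satisfies
`HasMajorantA (geomT D) (blkV1 hN D) (y′ ∈ Q^T_□ ∧ NormSupp (blkV1) {y′} (holderV1 ε + supNormV1)) (·) (C_ε·e^{−ρ d_T(y,y′)})` — print's
`O(1)e^{−δ₃d}(‖J‖_ε + |J|)` for the two-difference member, with NO length prefactor.
[cite: Balaban1984PropagatorsII, Prop. 2.6 (2.138) p.247, (2.133) p.247, p.238; Balaban1984PropagatorsI, Prop. 1.2 (1.112) p.36] -/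
theorem hDGDla_cube (d ℓ : ℕ) (hd : 1 ≤ d + 1) (hL : Odd (ℓ + 1) ∧ 1 < ℓ + 1) {a₀ a₁ : ℝ} (ha₀ : 0 < a₀) (ha₁ : a₀ ≤ a₁) :
    ∃ ρ : ℝ, 0 < ρ ∧ ∀ ε : ℝ, 0 < ε → ε < 1 → ∃ C : ℝ, 0 ≤ C ∧ ∀ (m K : ℕ) {Mh k R : ℕ} {P' : Fin (d + 1) → ℕ}
      (hN : ∀ μ, N0 ℓ Mh k P' μ = (PV d ℓ m K hd hL).sitesPerDir 0) (D : TDomains d ℓ Mh k P' R) (hk : k ≤ m + K)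
      (hMh1 : 1 ≤ Mh) (hP4 : ∀ μ, 4 ≤ P' μ) {a : ℕ} (hMha : Mh = (ℓ + 1) ^ a) (_ : 2 ≤ Mh) (_ : 2 * (ℓ + 1) ^ 2 ≤ R) (_ : 4 ≤ ℓ)
      (c : ↥(cubes D.toDomains)) (hpl : Placed ℓ k P' c.1) (w : BondIdx (domT hN D hk) → ℝ) (cf : ℝ) (μ ν : Fin (d + 1)),
      HasMajorantA (g := geomT D) (blkV1 hN D)
        (fun J y' B => y' ∈ ST D hMh1 hP4 c ∧ NormSupp (g := geomT D) (blkV1 hN D) (fun y' => ({y'} : Set (geomT D).Site))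
          (fun _ J => holderV1 hN D ε J + supNormV1 J) J y' B)
        (TB (-vch Mh k (svec ℓ k c.1.1 c.1.2)) *
          transplant (cB (tC hN hk hMh1 hP4 c ha₁ a (wC hN hk c w) cf) (x0 ℓ Mh k c.1) (hx0 hpl) (hfit hN hMh1 hP4 hMha c ha₁ hpl)).W
            (eB (tC hN hk hMh1 hP4 c ha₁ a (wC hN hk c w) cf) (x0 ℓ Mh k c.1))
            (onFun ((tC hN hk hMh1 hP4 c ha₁ a (wC hN hk c w) cf).Dl μ ∘ₗ (tC hN hk hMh1 hP4 c ha₁ a (wC hN hk c w) cf).D.G ∘ₗ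
              (tC hN hk hMh1 hP4 c ha₁ a (wC hN hk c w) cf).Dla ν)) *
          TB (vch Mh k (svec ℓ k c.1.1 c.1.2)))
        (fun y y' => C * Real.exp (-(ρ * (geomT D).dist y y'))) := by
  obtain ⟨δ, hδ, HE⟩ := ineq112_hasMajorantA_rad d (ℓ + 1) hd hL ha₀ ha₁
  refine ⟨δ / (((d : ℝ) + 1) * ((9 : ℕ) : ℝ)), by positivity, fun ε hε0 hε1 => ?_⟩
  obtain ⟨CE, hCE, hE⟩ := HE ε hε0 hε1
  refine ⟨3 * (CE * Real.exp ((1 + 2 * δ) * ((ℓ : ℝ) + 3)) * Real.exp (δ * (((d : ℝ) + 1) + ((d : ℝ) + 1)) / (((d : ℝ) + 1) * ((9 : ℕ) : ℝ)))),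
    by positivity, ?_⟩
  intro m K Mh k R P' hN D hk hMh1 hP4 a hMha hMh hR2 hℓ c hpl w cf μ ν
  have hmem := hE (ℓ : ℝ) (Nat.cast_nonneg ℓ) (tC hN hk hMh1 hP4 c ha₁ a (wC hN hk c w) cf) 0 0 μ ν
  exact normSuppDecay_cube hN hk hMh1 hP4 hMha c ha₁ hℓ hMh hR2 hpl w cf hε0.le (by positivity) hδ.le hmem

/-- **p38's `E_(μ,+)·G_□·E_(ν,−)` ON THE CENSUS HÖLDER CLASS, PER CUBE**: the same with the rescaling unit `s(□)⁻¹ = (L^{j₀}/c′)²` in the kernel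
(cancelled downstream by the two `(c′/L^{j₀})` of `…B6GradLegKLevelV1.mulOp_mul_EC_true` and its transpose).
[cite: Balaban1984PropagatorsII, Prop. 2.6 (2.138) p.247, (2.92)–(2.94) p.239; Balaban1984PropagatorsI, Prop. 1.2 (1.112) p.36] -/
theorem hEGE_cube (d ℓ : ℕ) (hd : 1 ≤ d + 1) (hL : Odd (ℓ + 1) ∧ 1 < ℓ + 1) {a₀ a₁ : ℝ} (ha₀ : 0 < a₀) (ha₁ : a₀ ≤ a₁) :
    ∃ ρ : ℝ, 0 < ρ ∧ ∀ ε : ℝ, 0 < ε → ε < 1 → ∃ C : ℝ, 0 ≤ C ∧ ∀ (m K : ℕ) {Mh k R : ℕ} {P' : Fin (d + 1) → ℕ}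
      (hN : ∀ μ, N0 ℓ Mh k P' μ = (PV d ℓ m K hd hL).sitesPerDir 0) (D : TDomains d ℓ Mh k P' R) (hk : k ≤ m + K)
      (hMh1 : 1 ≤ Mh) (hP4 : ∀ μ, 4 ≤ P' μ) {a : ℕ} (hMha : Mh = (ℓ + 1) ^ a) (_ : 2 ≤ Mh) (_ : 2 * (ℓ + 1) ^ 2 ≤ R) (_ : 4 ≤ ℓ)
      (c : ↥(cubes D.toDomains)) (hpl : Placed ℓ k P' c.1) (w : BondIdx (domT hN D hk) → ℝ) (cf : ℝ) (μ ν : Fin (d + 1)),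
      HasMajorantA (g := geomT D) (blkV1 hN D)
        (fun J y' B => y' ∈ ST D hMh1 hP4 c ∧ NormSupp (g := geomT D) (blkV1 hN D) (fun y' => ({y'} : Set (geomT D).Site))
          (fun _ J => holderV1 hN D ε J + supNormV1 J) J y' B)
        (EC hN hk hMh1 hP4 hMha c ha₁ hpl w cf (μ, true) * Gl hN hk hMh1 hP4 hMha c ha₁ hpl w cf * EC hN hk hMh1 hP4 hMha c ha₁ hpl w cf (ν, false))
        (fun y y' => (sc hMh1 hP4 c cf)⁻¹ * (C * Real.exp (-(ρ * (geomT D).dist y y')))) := by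
  obtain ⟨ρ, hρ, H⟩ := hDGDla_cube d ℓ hd hL ha₀ ha₁
  refine ⟨ρ, hρ, fun ε hε0 hε1 => ?_⟩
  obtain ⟨C, hC, h⟩ := H ε hε0 hε1
  refine ⟨C, hC, ?_⟩
  intro m K Mh k R P' hN D hk hMh1 hP4 a hMha hMh hR2 hℓ c hpl w cf μ ν
  have h0 := h m K hN D hk hMh1 hP4 hMha hMh hR2 hℓ c hpl w cf μ ν
  have h1 := hasMajorantA_smul (g := geomT D) (blkV1 hN D) h0 (sc hMh1 hP4 c cf)⁻¹
  rw [EC_Gl_EC_eq, mul_smul_comm, smul_mul_assoc]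
  refine hasMajorantA_mono (g := geomT D) (blkV1 hN D) h1 (fun _ _ _ hμ => hμ.2.nonneg) fun a b => ?_
  rw [abs_of_nonneg (inv_nonneg.2 (sc_nonneg hMh1 hP4 c cf))]

end Letter

end Literature.MathematicalPhysics.QuantumFieldTheory.Balaban1983to89.B6CubeNormSuppInDecayV1

end
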